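import Summits.NavierStokesRegularity.FluidComputer.RiccatiSlice
import Summits.NavierStokesRegularity.FluidComputer.GeometricFace
import HarnessLib

/-!
# Fluid computer — support: the integrated Riccati inequality of the `Ḃ^{3/2}_{2,2}` row along a maximal solution

HONEST FRAMING (cell `pub-fluidc`, verbatim): *low prior, high value-of-information experiment on Tao's
machine paradigm; NOT a claim that NS blows up.* Support file of the OPTIMAL `Ḃ^{3/2}_{2,2}` row (`Besov32Clock`). Along
every maximal smooth solution `(u, p)` of the unforced Navier–Stokes system on `ℝ³ × [0, T)` (`ν > 0`) which is
Leray–Hopf from `u 0`, write `a_j(τ) = ‖Δ̇_j u(τ)‖₂` and `Y(τ) = ∑_{j∈ℤ} 8^j a_j(τ)²` (the `Ḃ^{3/2}_{2,2}` row; real-valued,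
finite on `(0, T)`):

* `exists_thirdSum_le` — on every `[s, t] ⊂ (0, T)` the third derivatives and the energy of the slices are UNIFORMLY
  bounded (Tao's persistence of regularity for the interior translate, `GeometricFace.hasBoundedSobolevNormsOn_translate`,
  read through `exists_gradSq_thirdSum_le`; Leray's energy inequality);
* `besov32_ne_top`, `continuousOn_besov32` — `Y` is finite on `(0, T)` and CONTINUOUS on every `[s, t] ⊂ (0, T)`
  (each `a_j(·)²` is continuous, `BlockEnergyContinuity`; the windows `∑_{|j|≤L}` converge to `Y` uniformly on
  `[s, t]` by the uniform tails `RiccatiSlice.tsum_weighted_sq_le_window_add`);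
* `besov32_two_point` (**THE RICCATI INEQUALITY, integrated; Cheskidov–Zaya 2016 Thm. 2.2**) — there is an absolute
  `K > 0` with `Y(t) − Y(s) ≤ (K/ν) ∫_s^t Y(τ)² dτ` for all `0 < s ≤ t < T`: the signed block balances
  (`BlockEnergyIdentity.blockL2_sq_toReal_sub_eq`) weighted by `8^j` and summed over `|j| ≤ L`, the slice bound
  `RiccatiSlice.weighted_slice_le` integrated in time, and `L → ∞` (the truncation error `2^{−L}·R·(t−s)` vanishes; no
  infinite sum is ever differentiated). This is the integral form of `Y' ≤ (K/ν) Y²`.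

0 sorry; no definitions; no named facts.

## References

* A. Cheskidov, K. Zaya, J. Math. Phys. 57 (2016) 023101 = arXiv:1503.01784, Thm. 2.2 (p. 5). [CheskidovZaya2016]
* A. Cheskidov, R. Shvydkoy, Arch. Ration. Mech. Anal. 195 (2010) 159–169, Lemma 3.2 (proof, (8)). [CheskidovShvydkoy2010]
* T. Tao, *Localisation and compactness properties of the Navier–Stokes global regularity problem*, Anal. PDE 6
  (2013) = arXiv:1108.1165, Cor. 11.1. [Tao2011]
-/

noncomputable section

open MeasureTheory Set Function Filter Topology
open scoped ENNReal NNReal RealInnerProductSpace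
open Literature.Analysis.FluidPDE Literature.Analysis.FunctionSpaces
open Literature.Analysis.FluidPDE.LPBounds (thirdSum)
open Summit.NavierStokesRegularity.FluidComputer.BlockEnergyTransport
open Summit.NavierStokesRegularity.FluidComputer.BlockEnergyIdentity
open Summit.NavierStokesRegularity.FluidComputer.BlockEnergyContinuity
open Summit.NavierStokesRegularity.FluidComputer.RiccatiSlice

namespace Summit.NavierStokesRegularity.FluidComputer.RiccatiInequality

/-! ## Uniform third-derivative and energy bounds on interior windows -/

/-- **Uniform data of an interior window.** For a maximal smooth solution `(u, p)` of the unforced system on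
`ℝ³ × [0, T)` (`ν > 0`), Leray–Hopf from `u 0`, and `0 < s ≤ t < T`: there are `S₃, E₀` with `T₃(u(τ)) ≤ S₃`
(`T₃ = LPBounds.thirdSum`, the third-derivative sum) and `‖u(τ)‖₂ ≤ E₀` for every `τ ∈ [s, t]` — the interior translate
`u(· + s)` lies in the Beale–Kato–Majda class on `[0, t − s]` (`GeometricFace.hasBoundedSobolevNormsOn_translate`), and the
energy never exceeds `‖u(0)‖₂`. [cite: Tao2011, Cor. 11.1] -/
theorem exists_thirdSum_le {ν T : ℝ} (hν : 0 < ν) (hT : 0 < T)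
    {u : ℝ → EuclideanSpace ℝ (Fin 3) → EuclideanSpace ℝ (Fin 3)} {p : ℝ → EuclideanSpace ℝ (Fin 3) → ℝ}
    (hmax : IsMaximalSmoothSolution ν 0 u p T) (hLH : IsLerayHopfOn T ν 0 (u 0) u)
    {s t : ℝ} (hs : 0 < s) (hst : s ≤ t) (htT : t < T) :
    ∃ S₃ E₀ : ℝ≥0, ∀ τ ∈ Icc s t, thirdSum (u τ) ≤ S₃ ∧ eLpNorm (u τ) 2 volume ≤ E₀ := by
  have hsI : s ∈ Ioo 0 T := ⟨hs, hst.trans_lt htT⟩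
  have hSob := GeometricFace.hasBoundedSobolevNormsOn_translate hν hT hmax hLH hsI (T'' := t - s) (by linarith)
  have hsm : ∀ τ ∈ Icc 0 (t - s), IsSmoothL2Field ((fun τ' => u (τ' + s)) τ) := fun τ hτ =>
    isSmoothL2Field_slice_of_maximal hν hT hmax hLH ⟨by linarith [hτ.1], by linarith [hτ.2]⟩
  obtain ⟨_, S₃, hS⟩ := exists_gradSq_thirdSum_le hSob hsm
  obtain ⟨E₀, hE₀⟩ := exists_eLpNorm_slice_le hLH hν.le
  refine ⟨S₃, E₀, fun τ hτ => ⟨?_, hE₀ τ ⟨(hs.trans_le hτ.1).le, (hτ.2.trans_lt htT).le⟩⟩⟩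
  have h := (hS (τ - s) ⟨by linarith [hτ.1], by linarith [hτ.2]⟩).2
  simpa only [sub_add_cancel] using h

/-! ## Finiteness and time-continuity of the `Ḃ^{3/2}_{2,2}` row -/

/-- **The `Ḃ^{3/2}_{2,2}` row is finite on the open lifespan**: `∑_j 8^j ‖Δ̇_j u(τ)‖₂² < ∞` for `τ ∈ (0, T)` (the
slice is an `H^∞` field, `isSmoothL2Field_slice_of_maximal`; `RiccatiSlice.tsum_weighted_sq_ne_top`). [folklore] -/
theorem besov32_ne_top {ν T : ℝ} (hν : 0 < ν) (hT : 0 < T)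
    {u : ℝ → EuclideanSpace ℝ (Fin 3) → EuclideanSpace ℝ (Fin 3)} {p : ℝ → EuclideanSpace ℝ (Fin 3) → ℝ}
    (hmax : IsMaximalSmoothSolution ν 0 u p T) (hLH : IsLerayHopfOn T ν 0 (u 0) u) {τ : ℝ} (hτ : τ ∈ Ioo 0 T) :
    ∑' j : ℤ, (2 : ℝ≥0∞) ^ ((3 : ℝ) * (j : ℝ)) * blockL2 (u τ) j ^ 2 ≠ ∞ :=
  tsum_weighted_sq_ne_top (isSmoothL2Field_slice_of_maximal hν hT hmax hLH hτ) (by norm_num) (by norm_num)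

/-- **Time-continuity of the `Ḃ^{3/2}_{2,2}` row on interior windows**: `τ ↦ ∑_j 8^j ‖Δ̇_j u(τ)‖₂²` (as a real number)
is continuous on every `[s, t] ⊂ (0, T)` along a maximal smooth Leray–Hopf solution. The windows `∑_{|j|≤L}` are
continuous (`BlockEnergyContinuity.continuousOn_blockL2_sq`) and converge to the row UNIFORMLY on `[s, t]`, the tails
being at most `2^{−L}·((C_r³C₂S₃)² + (C₂E₀)²)` there (`RiccatiSlice.tsum_weighted_sq_le_window_add`, `exists_thirdSum_le`).
[folklore] -/
theorem continuousOn_besov32 {ν T : ℝ} (hν : 0 < ν) (hT : 0 < T)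
    {u : ℝ → EuclideanSpace ℝ (Fin 3) → EuclideanSpace ℝ (Fin 3)} {p : ℝ → EuclideanSpace ℝ (Fin 3) → ℝ}
    (hmax : IsMaximalSmoothSolution ν 0 u p T) (hLH : IsLerayHopfOn T ν 0 (u 0) u)
    {s t : ℝ} (hs : 0 < s) (hst : s ≤ t) (htT : t < T) :
    ContinuousOn (fun τ => (∑' j : ℤ, (2 : ℝ≥0∞) ^ ((3 : ℝ) * (j : ℝ)) * blockL2 (u τ) j ^ 2).toReal) (Icc s t) := by
  set K := lpBounds (Fin 3) with hK
  obtain ⟨S₃, E₀, hSE⟩ := exists_thirdSum_le hν hT hmax hLH hs hst htT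
  set W : ℤ → ℝ≥0∞ := fun j => (2 : ℝ≥0∞) ^ ((3 : ℝ) * (j : ℝ)) with hW
  set R : ℝ≥0∞ := ((K.Cr : ℝ≥0∞) ^ 3 * K.C₂ * S₃) ^ 2 + (K.C₂ * E₀) ^ 2 with hR
  set Y : ℝ → ℝ := fun τ => (∑' j : ℤ, W j * blockL2 (u τ) j ^ 2).toReal with hY
  set F : ℕ → ℝ → ℝ := fun L τ => ∑ j ∈ Finset.Icc (-(L : ℤ)) L, (W j * blockL2 (u τ) j ^ 2).toReal with hF
  have hsub : Icc s t ⊆ Ioo 0 T := fun τ hτ => ⟨hs.trans_le hτ.1, hτ.2.trans_lt htT⟩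
  have hw : ∀ τ ∈ Icc s t, IsSmoothL2Field (u τ) := fun τ hτ =>
    isSmoothL2Field_slice_of_maximal hν hT hmax hLH (hsub hτ)
  have hWtop : ∀ j, W j ≠ ∞ := fun j => RiccatiSlice.two_rpow_ne_top _
  have haj : ∀ τ ∈ Icc s t, ∀ j, blockL2 (u τ) j ^ 2 ≠ ∞ := fun τ hτ j =>
    ENNReal.pow_ne_top (((hw τ hτ).blockFn j).memLp_two).eLpNorm_ne_top
  have hRtop : R ≠ ∞ := ENNReal.add_ne_top.2 ⟨ENNReal.pow_ne_top (ENNReal.mul_ne_top (ENNReal.mul_ne_top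
      (ENNReal.pow_ne_top ENNReal.coe_ne_top) ENNReal.coe_ne_top) ENNReal.coe_ne_top),
      ENNReal.pow_ne_top (ENNReal.mul_ne_top ENNReal.coe_ne_top ENNReal.coe_ne_top)⟩
  have hytop : ∀ τ ∈ Icc s t, ∑' j : ℤ, W j * blockL2 (u τ) j ^ 2 ≠ ∞ := fun τ hτ =>
    tsum_weighted_sq_ne_top (hw τ hτ) (by norm_num) (by norm_num)
  -- the windows are continuous
  have hFc : ∀ L, ContinuousOn (F L) (Icc s t) := by
    intro L
    refine continuousOn_finsetSum _ fun j _ => ?_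
    have h1 : ContinuousOn (fun τ => W j * blockL2 (u τ) j ^ 2) (Icc s t) :=
      (ENNReal.continuous_const_mul (hWtop j)).comp_continuousOn
        ((continuousOn_blockL2_sq hν hT hmax hLH j).mono hsub)
    exact ENNReal.continuousOn_toReal.comp h1 fun τ hτ => ENNReal.mul_ne_top (hWtop j) (haj τ hτ j)
  -- the windows approximate the row uniformly
  have hclose : ∀ L τ, τ ∈ Icc s t → dist (Y τ) (F L τ) ≤ ((2⁻¹ : ℝ≥0∞) ^ L * R).toReal := by
    intro L τ hτ
    set yL : ℝ≥0∞ := ∑ j ∈ Finset.Icc (-(L : ℤ)) L, W j * blockL2 (u τ) j ^ 2 with hyL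
    have hyLtop : yL ≠ ∞ := ENNReal.sum_ne_top.2 fun j _ => ENNReal.mul_ne_top (hWtop j) (haj τ hτ j)
    have hFL : F L τ = yL.toReal := by
      rw [hyL, ENNReal.toReal_sum fun j _ => ENNReal.mul_ne_top (hWtop j) (haj τ hτ j)]
    have hlow : yL ≤ ∑' j : ℤ, W j * blockL2 (u τ) j ^ 2 := ENNReal.sum_le_tsum _
    have hup : ∑' j : ℤ, W j * blockL2 (u τ) j ^ 2 ≤ yL + (2⁻¹ : ℝ≥0∞) ^ L * R :=
      tsum_weighted_sq_le_window_add (hw τ hτ) (by exact_mod_cast (hSE τ hτ).1) (by exact_mod_cast (hSE τ hτ).2)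
        (by norm_num) (by norm_num) L
    have h1 : yL.toReal ≤ Y τ := ENNReal.toReal_mono (hytop τ hτ) hlow
    have h2 : Y τ ≤ yL.toReal + ((2⁻¹ : ℝ≥0∞) ^ L * R).toReal := by
      rw [hY]
      simp only
      rw [← ENNReal.toReal_add hyLtop (ENNReal.mul_ne_top (ENNReal.pow_ne_top (by norm_num)) hRtop)]
      exact ENNReal.toReal_mono (ENNReal.add_ne_top.2 ⟨hyLtop,
        ENNReal.mul_ne_top (ENNReal.pow_ne_top (by norm_num)) hRtop⟩) hup
    rw [hFL, Real.dist_eq, abs_of_nonneg (by linarith)]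
    linarith
  have hρ : Tendsto (fun L : ℕ => ((2⁻¹ : ℝ≥0∞) ^ L * R).toReal) atTop (𝓝 0) := by
    have h4 : Tendsto (fun L : ℕ => (2⁻¹ : ℝ≥0∞) ^ L) atTop (𝓝 0) :=
      ENNReal.tendsto_pow_atTop_nhds_zero_of_lt_one (by norm_num)
    have h5 := ENNReal.Tendsto.mul_const h4 (Or.inr hRtop)
    rw [zero_mul] at h5
    have h6 := (ENNReal.tendsto_toReal ENNReal.zero_ne_top).comp h5
    rwa [ENNReal.toReal_zero] at h6
  have hunif : TendstoUniformlyOn F Y atTop (Icc s t) := by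
    refine Metric.tendstoUniformlyOn_iff.2 fun ε hε => ?_
    filter_upwards [(tendsto_order.1 hρ).2 ε hε] with L hL τ hτ
    exact (hclose L τ hτ).trans_lt hL
  exact hunif.continuousOn (Eventually.of_forall hFc).frequently

/-! ## The integrated Riccati inequality -/

/-- **THE RICCATI INEQUALITY OF THE `Ḃ^{3/2}_{2,2}` ROW (Cheskidov–Zaya 2016, Thm. 2.2, integrated form).** There is an
absolute `K > 0` such that for every `ν > 0`, `T > 0`, every maximal smooth solution `(u, p)` of the unforced
Navier–Stokes system on `ℝ³ × [0, T)` which is Leray–Hopf from `u 0`, and all `0 < s ≤ t < T`: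
`Y(t) − Y(s) ≤ (K/ν) ∫_s^t Y(τ)² dτ`, `Y(τ) = ∑_{j∈ℤ} 8^j ‖Δ̇_j u(τ)‖₂²`.
Proof: for each `L`, the signed block balances `‖Δ̇_j u(t)‖₂² − ‖Δ̇_j u(s)‖₂² = 2∫_s^t(−ν S_j − N_j)`
(`blockL2_sq_toReal_sub_eq`) weighted by `8^j` and summed over `|j| ≤ L`; the integrand is bounded slice by slice by
`RiccatiSlice.weighted_slice_le` (`≤ ν/(3C_r²+1)·2^{−L} R + (K₁/ν) Y²`, with `R` fixed on `[s, t]` by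
`exists_thirdSum_le`); integrate (`Y` is continuous, `continuousOn_besov32`) and let `L → ∞`. `K = 2K₁`.
[cite: CheskidovZaya2016, Thm. 2.2 (p. 5)] [cite: CheskidovShvydkoy2010, Lemma 3.2 (proof, (8))] -/
theorem besov32_two_point :
    ∃ K : ℝ, 0 < K ∧ ∀ (ν T : ℝ), 0 < ν → 0 < T →
      ∀ (u : ℝ → EuclideanSpace ℝ (Fin 3) → EuclideanSpace ℝ (Fin 3)) (p : ℝ → EuclideanSpace ℝ (Fin 3) → ℝ),
      IsMaximalSmoothSolution ν 0 u p T → IsLerayHopfOn T ν 0 (u 0) u →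
      ∀ s t : ℝ, 0 < s → s ≤ t → t < T →
        (∑' j : ℤ, (2 : ℝ≥0∞) ^ ((3 : ℝ) * (j : ℝ)) * blockL2 (u t) j ^ 2).toReal -
            (∑' j : ℤ, (2 : ℝ≥0∞) ^ ((3 : ℝ) * (j : ℝ)) * blockL2 (u s) j ^ 2).toReal ≤
          K / ν * ∫ τ in s..t, ((∑' j : ℤ, (2 : ℝ≥0∞) ^ ((3 : ℝ) * (j : ℝ)) * blockL2 (u τ) j ^ 2).toReal) ^ 2 := by
  obtain ⟨K₁, hK₁, hslice⟩ := weighted_slice_le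
  refine ⟨2 * K₁, by positivity, fun ν T hν hT u p hmax hLH s t hs hst htT => ?_⟩
  set K := lpBounds (Fin 3) with hK
  obtain ⟨S₃, E₀, hSE⟩ := exists_thirdSum_le hν hT hmax hLH hs hst htT
  set W : ℤ → ℝ≥0∞ := fun j => (2 : ℝ≥0∞) ^ ((3 : ℝ) * (j : ℝ)) with hW
  set R : ℝ≥0∞ := ((K.Cr : ℝ≥0∞) ^ 3 * K.C₂ * S₃) ^ 2 + (K.C₂ * E₀) ^ 2 with hR
  set ε : ℝ := ν / (3 * (K.Cr : ℝ) ^ 2 + 1) with hε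
  set Y : ℝ → ℝ := fun τ => (∑' j : ℤ, W j * blockL2 (u τ) j ^ 2).toReal with hY
  set F : ℕ → ℝ → ℝ := fun L τ =>
    ∑ j ∈ Finset.Icc (-(L : ℤ)) L, (W j).toReal * (blockL2 (u τ) j ^ 2).toReal with hF
  set g : ℤ → ℝ → ℝ := fun j τ =>
    -ν * (∑ i, ∫ x, ‖fderiv ℝ (blockFn j (u τ)) x (stdOrthonormalBasis ℝ (EuclideanSpace ℝ (Fin 3)) i)‖ ^ 2) -
      ∫ x, ⟪blockFn j (u τ) x, blockFn j (convect (u τ) (u τ)) x⟫ with hg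
  have hsub : Icc s t ⊆ Ioo 0 T := fun τ hτ => ⟨hs.trans_le hτ.1, hτ.2.trans_lt htT⟩
  have hw : ∀ τ ∈ Icc s t, IsSmoothL2Field (u τ) := fun τ hτ =>
    isSmoothL2Field_slice_of_maximal hν hT hmax hLH (hsub hτ)
  have hdiv : ∀ τ ∈ Icc s t, VectorCalculus.IsDivFree (u τ) := fun τ hτ =>
    hmax.1.divFree τ ⟨(hsub hτ).1.le, (hsub hτ).2⟩
  have hWtop : ∀ j, W j ≠ ∞ := fun j => RiccatiSlice.two_rpow_ne_top _
  have haj : ∀ τ ∈ Icc s t, ∀ j, blockL2 (u τ) j ^ 2 ≠ ∞ := fun τ hτ j =>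
    ENNReal.pow_ne_top (((hw τ hτ).blockFn j).memLp_two).eLpNorm_ne_top
  have hRtop : R ≠ ∞ := ENNReal.add_ne_top.2 ⟨ENNReal.pow_ne_top (ENNReal.mul_ne_top (ENNReal.mul_ne_top
      (ENNReal.pow_ne_top ENNReal.coe_ne_top) ENNReal.coe_ne_top) ENNReal.coe_ne_top),
      ENNReal.pow_ne_top (ENNReal.mul_ne_top ENNReal.coe_ne_top ENNReal.coe_ne_top)⟩
  have hytop : ∀ τ ∈ Icc s t, ∑' j : ℤ, W j * blockL2 (u τ) j ^ 2 ≠ ∞ := fun τ hτ =>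
    tsum_weighted_sq_ne_top (hw τ hτ) (by norm_num) (by norm_num)
  have hYc : ContinuousOn Y (Icc s t) := continuousOn_besov32 hν hT hmax hLH hs hst htT
  have hYsq : IntervalIntegrable (fun τ => Y τ ^ 2) volume s t := by
    refine ContinuousOn.intervalIntegrable ?_
    rw [uIcc_of_le hst]
    exact hYc.pow 2
  -- the block balances and their integrability
  have hgint : ∀ j, IntervalIntegrable (g j) volume s t := fun j => by
    obtain ⟨hN, hS, -⟩ := blockL2_sq_toReal_sub_eq hν hT hmax hLH hs hst htT j
    exact (hS.const_mul (-ν)).sub hN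
  have hE : ∀ j, (blockL2 (u t) j ^ 2).toReal - (blockL2 (u s) j ^ 2).toReal = 2 * ∫ τ in s..t, g j τ := fun j =>
    (blockL2_sq_toReal_sub_eq hν hT hmax hLH hs hst htT j).2.2
  -- Step 1: the inequality at level `L`
  have hL : ∀ L : ℕ, F L t - F L s ≤
      2 * ((t - s) * (ε * ((2⁻¹ : ℝ≥0∞) ^ L * R).toReal) + K₁ / ν * ∫ τ in s..t, Y τ ^ 2) := by
    intro L
    set I : Finset ℤ := Finset.Icc (-(L : ℤ)) L with hI
    have hid : F L t - F L s = 2 * ∫ τ in s..t, ∑ j ∈ I, (W j).toReal * g j τ := by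
      show (∑ j ∈ I, (W j).toReal * (blockL2 (u t) j ^ 2).toReal) -
          ∑ j ∈ I, (W j).toReal * (blockL2 (u s) j ^ 2).toReal = _
      rw [← Finset.sum_sub_distrib, intervalIntegral.integral_finsetSum fun j _ => (hgint j).const_mul _,
        Finset.mul_sum]
      refine Finset.sum_congr rfl fun j _ => ?_
      rw [← mul_sub, hE j, intervalIntegral.integral_const_mul]
      ring
    have hint : IntervalIntegrable (fun τ => ∑ j ∈ I, (W j).toReal * g j τ) volume s t :=
      (IntervalIntegrable.sum I fun j _ => (hgint j).const_mul ((W j).toReal)).congr fun τ _ => by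
        simp only [Finset.sum_apply]
    have hint' : IntervalIntegrable (fun τ => ε * ((2⁻¹ : ℝ≥0∞) ^ L * R).toReal + K₁ / ν * Y τ ^ 2) volume s t :=
      intervalIntegrable_const.add (hYsq.const_mul _)
    have hbound : ∀ τ ∈ Icc s t, ∑ j ∈ I, (W j).toReal * g j τ ≤
        ε * ((2⁻¹ : ℝ≥0∞) ^ L * R).toReal + K₁ / ν * Y τ ^ 2 := fun τ hτ =>
      hslice ν hν (u τ) (hw τ hτ) (hdiv τ hτ) S₃ E₀ (hSE τ hτ).1 (hSE τ hτ).2 L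
    have hmono := intervalIntegral.integral_mono_on hst hint hint' hbound
    rw [hid]
    rw [intervalIntegral.integral_add intervalIntegrable_const (hYsq.const_mul _), intervalIntegral.integral_const,
      intervalIntegral.integral_const_mul, smul_eq_mul] at hmono
    linarith
  -- Step 2: `L → ∞`
  have hlimF : ∀ τ ∈ Icc s t, Tendsto (fun L : ℕ => F L τ) atTop (𝓝 (Y τ)) := by
    intro τ hτ
    have h1 : ∀ L : ℕ, F L τ = (∑ j ∈ Finset.Icc (-(L : ℤ)) L, W j * blockL2 (u τ) j ^ 2).toReal := by
      intro L
      rw [ENNReal.toReal_sum fun j _ => ENNReal.mul_ne_top (hWtop j) (haj τ hτ j)]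
      exact Finset.sum_congr rfl fun j _ => (ENNReal.toReal_mul).symm
    simp_rw [h1]
    exact (ENNReal.tendsto_toReal (hytop τ hτ)).comp (tendsto_sum_Icc_atTop _)
  have hρ : Tendsto (fun L : ℕ => ((2⁻¹ : ℝ≥0∞) ^ L * R).toReal) atTop (𝓝 0) := by
    have h4 : Tendsto (fun L : ℕ => (2⁻¹ : ℝ≥0∞) ^ L) atTop (𝓝 0) :=
      ENNReal.tendsto_pow_atTop_nhds_zero_of_lt_one (by norm_num)
    have h5 := ENNReal.Tendsto.mul_const h4 (Or.inr hRtop)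
    rw [zero_mul] at h5
    have h6 := (ENNReal.tendsto_toReal ENNReal.zero_ne_top).comp h5
    rwa [ENNReal.toReal_zero] at h6
  have hlim := le_of_tendsto_of_tendsto ((hlimF t ⟨hst, le_rfl⟩).sub (hlimF s ⟨le_rfl, hst⟩))
    (((tendsto_const_nhds.mul (hρ.const_mul ε)).add tendsto_const_nhds).const_mul 2) (Eventually.of_forall hL)
  have e : 2 * ((t - s) * (ε * 0) + K₁ / ν * ∫ τ in s..t, Y τ ^ 2) = 2 * K₁ / ν * ∫ τ in s..t, Y τ ^ 2 := by ring
  exact hlim.trans_eq e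

end Summit.NavierStokesRegularity.FluidComputer.RiccatiInequality

end
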